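import Mathlib
import Summits.Ventures.PercRepro2.K5Theorem
import Summits.Ventures.PercRepro2.HubBernstein
import Summits.Ventures.PercRepro2.PMK5Kernel
import Summits.Ventures.PercRepro2.PMK5KernelA
import Summits.Ventures.PercRepro2.PMK5Bridge
import Summits.Ventures.PercRepro2.PMK5Theorem

/-!
# THE TYPED BRACKET `β₁` OF THE (PM) IS TENSOR-BERNSTEIN-POSITIVE ON `K₅`: every degree-3 coefficient of
`β₁ = (HALF-PM⁺)_L + (HALF-PM⁺)_H + A` is `≥ 0` (blind cell PercRepro2, mine-2 g22; row 2′BETA1; the (TB) form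
of the typed (PM), M2-44 (19), on every 5-vertex base graph — kernel-checked)

The per-side brackets are Bernstein-positive by `PMK5Bridge.lean`; here the `a₃`-inactive piece
`A = (P(uU Q) − P(Q))·[P(Q)P(L_bH_oQ) − P(L_bQ)P(H_oQ) + P(Q)P(H_bL_oQ) − P(H_bQ)P(L_oQ)]` (eight products of
three masses) gets the same treatment from the kernel certificate `PM.certA` (`cntNegA_le_cntPosA`), and the
three Bernstein expansions add: `beta1_eq_bern` writes the cleared `β₁` of `RootPairSepTyped.lean` as
`Σ_k bern p k · (cntPosB k − cntNegB k)` and `cntNegB_le_cntPosB` says every coefficient is `≥ 0`.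
By mine-2's dictionary (M2-34: `S₁(τ) − S₀(τ) = 2 Π_τ · β₁(τ)`, the coefficient at the type profile `τ`) this is
the typed (PM) `S₁ ≥ S₀` for every type map on every graph on the five marks — stated here in the
tensor-Bernstein vocabulary only; night-3's `CovForm.TypedRed.PM` (typed counts) is NOT bridged.
-/

namespace Summit.Ventures.PercRepro2

open Hub

namespace K5

namespace PM

/-! ## The table `uU ∩ Q`, and the counts of `A` -/

section Digits

/-- `tQuU ω ↔ ω ∈ {u ∈ C₁ ∪ C₂} ∩ Q`. -/
lemma tQuU_iff (ω : Fin 10 → Bool) :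
    tQuU ω = true ↔ ω ∈ (connEvent ends5 1 3 ∪ connEvent ends5 2 3) ∩ (connEvent ends5 1 2)ᶜ := by
  unfold tQuU
  rw [Bool.and_eq_true, Bool.or_eq_true, tQ_iff_compl, conn_iff_mem ω (by norm_num) (by norm_num),
    conn_iff_mem ω (by norm_num) (by norm_num)]
  simp only [Set.mem_inter_iff, Set.mem_union]; tauto

/-- The positive triple counts of the cleared `A`. -/
def cntPosA (k : Fin 10 → Fin 4) : ℕ :=
  cnt3 tQuU tQ tQBLHo k + cnt3 tQuU tQ tQBLo k + cnt3 tQ tQBL tQHo k + cnt3 tQ tQB tQLo k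

/-- The negative triple counts of the cleared `A`. -/
def cntNegA (k : Fin 10 → Fin 4) : ℕ :=
  cnt3 tQuU tQBL tQHo k + cnt3 tQuU tQB tQLo k + cnt3 tQ tQ tQBLHo k + cnt3 tQ tQ tQBLo k

/-- Four Kronecker sums combine (coefficient functions as variables, as in `K5.sum_add_mul5`). -/
lemma sum_add4_mul5 (f g h i : (Fin 10 → Fin 4) → ℕ) :
    ∑ k, f k * KB ^ idx4 k + ∑ k, g k * KB ^ idx4 k + ∑ k, h k * KB ^ idx4 k + ∑ k, i k * KB ^ idx4 k =
      ∑ k, (f k + g k + h k + i k) * KB ^ idx4 k := by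
  rw [sum_add_mul5, sum_add_mul5, sum_add_mul5]

/-- `kPosA` carries the positive counts. -/
lemma kPosA_eq : kPosA = ∑ k, cntPosA k * KB ^ idx4 k :=
  calc kPosA = kronSum tQuU * kronSum tQ * kronSum tQBLHo + kronSum tQuU * kronSum tQ * kronSum tQBLo +
        kronSum tQ * kronSum tQBL * kronSum tQHo + kronSum tQ * kronSum tQB * kronSum tQLo := by
        unfold kPosA
        rw [kron_eq_kronSum tQuU, kron_eq_kronSum tQ, kron_eq_kronSum tQBLHo, kron_eq_kronSum tQBLo,
          kron_eq_kronSum tQBL, kron_eq_kronSum tQHo, kron_eq_kronSum tQB, kron_eq_kronSum tQLo]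
    _ = ∑ k, cnt3 tQuU tQ tQBLHo k * KB ^ idx4 k + ∑ k, cnt3 tQuU tQ tQBLo k * KB ^ idx4 k +
        ∑ k, cnt3 tQ tQBL tQHo k * KB ^ idx4 k + ∑ k, cnt3 tQ tQB tQLo k * KB ^ idx4 k := by
        rw [kronSum_mul_mul, kronSum_mul_mul, kronSum_mul_mul, kronSum_mul_mul]
    _ = ∑ k, cntPosA k * KB ^ idx4 k := sum_add4_mul5 _ _ _ _

/-- `kNegA` carries the negative counts. -/
lemma kNegA_eq : kNegA = ∑ k, cntNegA k * KB ^ idx4 k :=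
  calc kNegA = kronSum tQuU * kronSum tQBL * kronSum tQHo + kronSum tQuU * kronSum tQB * kronSum tQLo +
        kronSum tQ * kronSum tQ * kronSum tQBLHo + kronSum tQ * kronSum tQ * kronSum tQBLo := by
        unfold kNegA
        rw [kron_eq_kronSum tQuU, kron_eq_kronSum tQ, kron_eq_kronSum tQBLHo, kron_eq_kronSum tQBLo,
          kron_eq_kronSum tQBL, kron_eq_kronSum tQHo, kron_eq_kronSum tQB, kron_eq_kronSum tQLo]
    _ = ∑ k, cnt3 tQuU tQBL tQHo k * KB ^ idx4 k + ∑ k, cnt3 tQuU tQB tQLo k * KB ^ idx4 k +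
        ∑ k, cnt3 tQ tQ tQBLHo k * KB ^ idx4 k + ∑ k, cnt3 tQ tQ tQBLo k * KB ^ idx4 k := by
        rw [kronSum_mul_mul, kronSum_mul_mul, kronSum_mul_mul, kronSum_mul_mul]
    _ = ∑ k, cntNegA k * KB ^ idx4 k := sum_add4_mul5 _ _ _ _

/-- The counts are bounded by `4 · 3^10 < 2^19`. -/
lemma cntPosA_lt (k : Fin 10 → Fin 4) : cntPosA k < 2 ^ 19 := by
  unfold cntPosA
  have := cnt3_le tQuU tQ tQBLHo k
  have := cnt3_le tQuU tQ tQBLo k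
  have := cnt3_le tQ tQBL tQHo k
  have := cnt3_le tQ tQB tQLo k
  omega

/-- The counts are bounded by `4 · 3^10 < 2^19`. -/
lemma cntNegA_lt (k : Fin 10 → Fin 4) : cntNegA k < 2 ^ 19 := by
  unfold cntNegA
  have := cnt3_le tQuU tQBL tQHo k
  have := cnt3_le tQuU tQB tQLo k
  have := cnt3_le tQ tQ tQBLHo k
  have := cnt3_le tQ tQ tQBLo k
  omega

/-- **Every Bernstein coefficient of the cleared `A` is `≥ 0`** (from the kernel certificate `certA`). -/
theorem cntNegA_le_cntPosA (k : Fin 10 → Fin 4) : cntNegA k ≤ cntPosA k :=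
  le_of_kron_le cntPosA cntNegA cntPosA_lt cntNegA_lt kPosA_eq kNegA_eq certA.1 certA.2.1 k

/-- The positive triple counts of the cleared `β₁ = L + H + A`. -/
def cntPosB (k : Fin 10 → Fin 4) : ℕ := cntPosL k + cntPosH k + cntPosA k

/-- The negative triple counts of the cleared `β₁ = L + H + A`. -/
def cntNegB (k : Fin 10 → Fin 4) : ℕ := cntNegL k + cntNegH k + cntNegA k

/-- **Every Bernstein coefficient of the cleared typed bracket `β₁` is `≥ 0` on `K₅`.** -/
theorem cntNegB_le_cntPosB (k : Fin 10 → Fin 4) : cntNegB k ≤ cntPosB k := by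
  unfold cntPosB cntNegB
  have := cntNegL_le_cntPosL k
  have := cntNegH_le_cntPosH k
  have := cntNegA_le_cntPosA k
  omega

end Digits

/-! ## `A` and `β₁` in the Bernstein basis -/

section Bernstein

variable {R : Type*} [Field R] [LinearOrder R] [IsStrictOrderedRing R]

omit [LinearOrder R] [IsStrictOrderedRing R] in
/-- **The cleared `a₃`-inactive piece `A` on `K₅` in the degree-3 Bernstein basis**. -/
theorem a3_eq_bern (p : Fin 10 → R) :
    (prob p ((connEvent ends5 1 3 ∪ connEvent ends5 2 3) ∩ (connEvent ends5 1 2)ᶜ) -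
          prob p (connEvent ends5 1 2)ᶜ) *
        (prob p (connEvent ends5 1 2)ᶜ *
              prob p (connEvent ends5 1 4 ∩ connEvent ends5 2 0 ∩ (connEvent ends5 1 2)ᶜ) -
            prob p (connEvent ends5 1 4 ∩ (connEvent ends5 1 2)ᶜ) *
              prob p (connEvent ends5 2 0 ∩ (connEvent ends5 1 2)ᶜ) +
          prob p (connEvent ends5 1 2)ᶜ *
              prob p (connEvent ends5 2 4 ∩ connEvent ends5 1 0 ∩ (connEvent ends5 1 2)ᶜ) -
            prob p (connEvent ends5 2 4 ∩ (connEvent ends5 1 2)ᶜ) *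
              prob p (connEvent ends5 1 0 ∩ (connEvent ends5 1 2)ᶜ)) =
      ∑ k, bern p k * ((cntPosA k : ℕ) - (cntNegA k : ℕ) : R) := by
  rw [prob_eq_bform p _ _ tQuU_iff, prob_eq_bform p _ _ tQ_iff_compl, prob_eq_bform p _ _ tQBLHo_iff,
    prob_eq_bform p _ _ tQBL_iff', prob_eq_bform p _ _ tQHo_iff, prob_eq_bform p _ _ tQBLo_iff,
    prob_eq_bform p _ _ tQB_iff', prob_eq_bform p _ _ tQLo_iff]
  have e : ∀ u q x c h y d l : R,
      (u - q) * (q * x - c * h + q * y - d * l) =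
        u * q * x + u * q * y + q * c * h + q * d * l - u * c * h - u * d * l - q * q * x - q * q * y := by
    intros; ring
  rw [e, bform_mul_mul, bform_mul_mul, bform_mul_mul, bform_mul_mul, bform_mul_mul, bform_mul_mul,
    bform_mul_mul, bform_mul_mul, ← Finset.sum_add_distrib, ← Finset.sum_add_distrib,
    ← Finset.sum_add_distrib, ← Finset.sum_sub_distrib, ← Finset.sum_sub_distrib, ← Finset.sum_sub_distrib,
    ← Finset.sum_sub_distrib]
  refine Finset.sum_congr rfl fun k _ => ?_
  rw [coef3_eq_cnt3, coef3_eq_cnt3, coef3_eq_cnt3, coef3_eq_cnt3, coef3_eq_cnt3, coef3_eq_cnt3,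
    coef3_eq_cnt3, coef3_eq_cnt3]
  unfold cntPosA cntNegA
  push_cast
  ring

omit [LinearOrder R] [IsStrictOrderedRing R] in
/-- **The cleared typed bracket `β₁ = L + H + A` on `K₅` in the degree-3 Bernstein basis**:
`Σ_k bern p k · (cntPosB k − cntNegB k)` (the expression of `RootPairSepTyped.beta1_eq_zero_of_b_alone`,
`(a₁, a₂, o, u, b) = (1, 2, 0, 3, 4)`). -/
theorem beta1_eq_bern (p : Fin 10 → R) :
    prob p (connEvent ends5 1 2)ᶜ *
          (prob p (connEvent ends5 1 2)ᶜ * prob p (connEvent ends5 1 4 ∩ connEvent ends5 2 3 ∩ (connEvent ends5 1 0 ∪ connEvent ends5 2 0) ∩ (connEvent ends5 1 2)ᶜ) -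
            prob p (connEvent ends5 1 4 ∩ (connEvent ends5 1 2)ᶜ) * prob p (connEvent ends5 2 3 ∩ (connEvent ends5 1 0 ∪ connEvent ends5 2 0) ∩ (connEvent ends5 1 2)ᶜ)) -
        prob p ((connEvent ends5 1 0 ∪ connEvent ends5 2 0) ∩ (connEvent ends5 1 2)ᶜ) *
          (prob p (connEvent ends5 1 2)ᶜ * prob p (connEvent ends5 1 4 ∩ connEvent ends5 2 3 ∩ (connEvent ends5 1 2)ᶜ) -
            prob p (connEvent ends5 1 4 ∩ (connEvent ends5 1 2)ᶜ) * prob p (connEvent ends5 2 3 ∩ (connEvent ends5 1 2)ᶜ)) -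
        prob p (connEvent ends5 1 2)ᶜ *
          (prob p (connEvent ends5 1 2)ᶜ * prob p (connEvent ends5 1 4 ∩ connEvent ends5 2 0 ∩ (connEvent ends5 1 2)ᶜ) -
            prob p (connEvent ends5 1 4 ∩ (connEvent ends5 1 2)ᶜ) * prob p (connEvent ends5 2 0 ∩ (connEvent ends5 1 2)ᶜ)) +
        prob p (connEvent ends5 1 2)ᶜ *
          (prob p (connEvent ends5 1 2)ᶜ * prob p (connEvent ends5 2 4 ∩ connEvent ends5 1 3 ∩ (connEvent ends5 1 0 ∪ connEvent ends5 2 0) ∩ (connEvent ends5 1 2)ᶜ) -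
            prob p (connEvent ends5 2 4 ∩ (connEvent ends5 1 2)ᶜ) * prob p (connEvent ends5 1 3 ∩ (connEvent ends5 1 0 ∪ connEvent ends5 2 0) ∩ (connEvent ends5 1 2)ᶜ)) -
        prob p ((connEvent ends5 1 0 ∪ connEvent ends5 2 0) ∩ (connEvent ends5 1 2)ᶜ) *
          (prob p (connEvent ends5 1 2)ᶜ * prob p (connEvent ends5 2 4 ∩ connEvent ends5 1 3 ∩ (connEvent ends5 1 2)ᶜ) -
            prob p (connEvent ends5 2 4 ∩ (connEvent ends5 1 2)ᶜ) * prob p (connEvent ends5 1 3 ∩ (connEvent ends5 1 2)ᶜ)) -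
        prob p (connEvent ends5 1 2)ᶜ *
          (prob p (connEvent ends5 1 2)ᶜ * prob p (connEvent ends5 2 4 ∩ connEvent ends5 1 0 ∩ (connEvent ends5 1 2)ᶜ) -
            prob p (connEvent ends5 2 4 ∩ (connEvent ends5 1 2)ᶜ) * prob p (connEvent ends5 1 0 ∩ (connEvent ends5 1 2)ᶜ)) +
        (prob p ((connEvent ends5 1 3 ∪ connEvent ends5 2 3) ∩ (connEvent ends5 1 2)ᶜ) - prob p (connEvent ends5 1 2)ᶜ) *
          (prob p (connEvent ends5 1 2)ᶜ * prob p (connEvent ends5 1 4 ∩ connEvent ends5 2 0 ∩ (connEvent ends5 1 2)ᶜ) - prob p (connEvent ends5 1 4 ∩ (connEvent ends5 1 2)ᶜ) * prob p (connEvent ends5 2 0 ∩ (connEvent ends5 1 2)ᶜ) +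
            prob p (connEvent ends5 1 2)ᶜ * prob p (connEvent ends5 2 4 ∩ connEvent ends5 1 0 ∩ (connEvent ends5 1 2)ᶜ) - prob p (connEvent ends5 2 4 ∩ (connEvent ends5 1 2)ᶜ) * prob p (connEvent ends5 1 0 ∩ (connEvent ends5 1 2)ᶜ)) =
      ∑ k, bern p k * ((cntPosB k : ℕ) - (cntNegB k : ℕ) : R) := by
  have e : ∀ a b c d e f g : R, a - b - c + d - e - f + g = (a - b - c) + (d - e - f) + g := by
    intros; ring
  rw [e, halfL_eq_bern, halfH_eq_bern, a3_eq_bern, ← Finset.sum_add_distrib, ← Finset.sum_add_distrib]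
  refine Finset.sum_congr rfl fun k _ => ?_
  unfold cntPosB cntNegB
  push_cast
  ring

end Bernstein

end PM

end K5

end Summit.Ventures.PercRepro2
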